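import Literature.MathematicalPhysics.QuantumLattice.StrongCouplingBosonisation
import Literature.MathematicalPhysics.QuantumLattice.GrassmannWardIdentity
import Literature.MathematicalPhysics.QuantumLattice.GrassmannIntegralBerezinProofs
import HarnessLib

/-!
# The chiral Ward identity for staggered fermions (Salmhofer–Seiler (3.43)) — at every gauge coupling

Salmhofer–Seiler, *Proof of chiral symmetry breaking in strongly coupled lattice gauge theory*,
Commun. Math. Phys. **139** (1991) 395–431, p. 409:

> "The Ward identities which one can derive by doing space-dependent chiral rotations relate the
> expectation value of `ψ̄ψ` directly to its two-point function for staggered fermions,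
> `⟨ψ̄ψ(y)⟩ = -m ∑_x ε(x)ε(y) ⟨ψ̄ψ(x) ψ̄ψ(y)⟩^T`  (3.43)
> (the truncation can be included because of the alternating signs `ε(x)` in the sum). Inserting
> the exponential decay with rate `κ(m)` into this equation one sees that if chiral symmetry is
> broken in the sense of `χ ≠ 0`, the mass gap `κ(m)` must go to zero as the mass vanishes. One may
> regard this as a weak version of the Goldstone theorem."  (Remark 3.12)

Here `ε(x) = (-1)^{∑_μ x_μ}` (2.8) "plays the role of `γ₅` for staggered fermions", and the chiral
symmetry (2.7) is `ψ(x) ↦ e^{iαε(x)}ψ(x)`, `ψ̄(x) ↦ e^{iαε(x)}ψ̄(x)`: "at mass `m = 0`, for all `β`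
and `g₄`, the action is invariant" (p. 398).

## What is proved (0 facts, 0 `sorry`)

The identity is an algebraic consequence of the invariance of the Berezin integral under the
infinitesimal axial rotation, and it holds **at fixed gauge field** `U` — hence for every lattice
gauge theory with this fermion action, at every gauge coupling `β`, after integrating `U` against an
arbitrary (finite) gauge-field measure.  We derive it with the even derivation `N_q = chargeOp ℂ q`
of `GrassmannWardIdentity` for the axial charge `q(ψ_a(x)) = q(ψ̄_a(x)) = ε(x)`:

* Part A (generic Grassmann algebra): `berezin_chargeOp` — `∫dθ N_q a = (∑ q) ∫dθ a`, so a charge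
  assignment of total charge zero is invisible to the Berezin integral (`berezin_chargeOp_eq_zero`,
  the invariance of `𝒟ψ̄𝒟ψ`); `chargeOp_grassmannExp_of_commute` — `N_q e^{A} = e^{A} N_q A` for
  nilpotent `A` commuting with `N_q A`.
* Part B (staggered fermions of `StrongCouplingBosonisation`, any finite site set `Λ`, links
  `l : B → Λ × Λ` joining sites of opposite parity `ε(l b).1 + ε(l b).2 = 0`): the kinetic term
  `hopAt` is axially neutral and the mass term has charge `2ε(x)` (`chargeOp_axial_negAction`), so
  `N_q e^{-S_F(U)} = e^{-S_F(U)} ∑_x 2mε(x)ψ̄ψ(x)` for EVERY `U` (`chargeOp_axial_fermiBoltzmann`);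
  with `∑_x ε(x) = 0` this gives the raw identity
  `ε(y) ∫dψ̄dψ ψ̄ψ(y) e^{-S_F(U)} = -m ∑_x ε(x) ∫dψ̄dψ ψ̄ψ(x)ψ̄ψ(y) e^{-S_F(U)}`
  (`ward_identity_fixedGauge`), the no-insertion identity `m∑_x ε(x)∫dψ̄dψ ψ̄ψ(x) e^{-S_F(U)} = 0`
  (`sum_mul_berezin_meson_eq_zero_of_chargeOp_eq`) which is exactly what makes the truncation
  free, and the normalised truncated form at fixed `U` (`ward_identity_fixedGauge_truncated`).
* Part C: integrating `U` against ANY finite measure `μ` on `U(N)^{B}` — e.g. `e^{-βS_g(U)}𝒟U`,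
  every `β ≥ 0` (`ward_identity_gaugeMeasure`, `ward_identity_gaugeMeasure_truncated`); and the
  `β = 0` theory of Salmhofer–Seiler (2.9)–(2.10) in the tree's honest Berezin–Haar vocabulary
  `fermiBracket` / `fermiExpect` (`ward_identity_fermiBracket`, `ward_identity_fermiExpect`,
  `ward_identity_fermiExpect_truncated`, `sum_mul_fermiExpect_meson_eq_zero`).
* Part D: the even torus `(ℤ/Lℤ)^ν` with `ε = ComplexSpin.sgn` and the links `(x, x + e_μ)`:
  `ward_identity_torus` (3.43) untruncated and `ward_identity_torus_truncated` (3.43) as printed, at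
  `β = 0`, all `N`, all even `L ≥ 2`, all link signs `Γ` (in particular the staggered phases (2.4)),
  every complex mass; `ward_identity_torus_gaugeMeasure[_truncated]` for every gauge-field measure.

* Part E (`m = 0`, appended): the exact symmetry gives `N_q e^{-S_F(U)}|_{m=0} = 0` for every
  `U`, whence the selection rule `∫dψ̄dψ F e^{-S_F(U)} = 0` for `F` of nonzero axial charge
  (`berezin_mul_fermiBoltzmann_massZero`); in particular "`⟨ψ̄ψ(x)⟩_{m=0} = 0`" in finite volume
  (p. 400) and **(3.101)/(3.106)** `⟨ψ̄ψ(x)ψ̄ψ(y)⟩ = 0` if `ε(x)ε(y) = 1`, `T̂(k + π̂) = -T̂(k)`, at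
  every gauge field / gauge-field measure / `β = 0` / on the even torus
  (`twoPoint_chiralGrading_fixedGauge`, `…_gaugeMeasure`, `fermiExpect_twoPoint_chiralGrading[_torus]`).
  (The bosonised `β = 0` versions of (3.101)/(3.106) are in `ComplexSpinChiralLRO`, and of (3.43) in
  `NJLChiralCondensateLowerBound.ward_identity`.)

Scope notes. (i) The paper states (3.43) for the `β = 0`, `g₄ = 0` expectation (2.10) and uses it in
the thermodynamic limit; we prove the finite-volume identity, which is what the derivation gives,
for every gauge-field weight — the limit statement follows termwise wherever the limits exist.
(ii) `g₄ > 0`: the four-fermion term (2.5) `ψ̄ψ(x)ψ̄ψ(x+e_μ)` has axial charge `2(ε(x)+ε(x+e_μ)) = 0`,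
so the same proof applies verbatim to `S_F + g₄S₄`; the tree's `fermiBoltzmann` has `g₄ = 0` and we
do not introduce a new action here. (iii) No new definition beyond the axial charge assignment
`axialCharge` (2.7); everything else is theorems over existing tree vocabulary.

## References
* [SalmhoferSeiler1991] M. Salmhofer, E. Seiler, Commun. Math. Phys. 139 (1991) 395–431, §2
  (2.3)–(2.10), (2.19); (3.43) and Remark 3.12, p. 409.
* [SalmhoferSeiler1992Erratum] iid., Commun. Math. Phys. 146 (1992) 637–638 (Remark 3.12 and (4.19)
  are where real-`m` clustering without `B₂(m)` is needed).
* [Berezin1966] F. A. Berezin, The Method of Second Quantization, Ch. I §3 (the Berezin integral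
  picks the top monomial; invariance under linear changes of generators).
-/

noncomputable section

namespace Literature.MathematicalPhysics.QuantumLattice

open GrassmannAlgebra

/-! ### Part A. The charge operator against the Berezin integral; charge of an exponential -/

section GenericLO

variable {Γ : Type*} [Fintype Γ] [LinearOrder Γ]

/-- The charge operator on an ordered product of generators multiplies by the total charge. [folklore] -/
private theorem chargeOp_list_prod_map_gen (q : Γ → ℂ) (l : List Γ) :
    chargeOp ℂ q ((l.map (gen ℂ)).prod) = (l.map q).sum • (l.map (gen ℂ)).prod := by
  induction l with
  | nil => simp
  | cons a l ih =>
    rw [List.map_cons, List.prod_cons, chargeOp_mul, ih, chargeOp_gen, List.map_cons, List.sum_cons,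
      add_smul, smul_mul_assoc, mul_smul_comm]

/-- The charge operator on a basis monomial: `N_q θ_s = (∑_{i ∈ s} q i) θ_s`. [folklore] -/
private theorem chargeOp_grassmannBasis (q : Γ → ℂ) (s : Finset Γ) :
    chargeOp ℂ q (grassmannBasis ℂ Γ s) = (∑ i ∈ s, q i) • grassmannBasis ℂ Γ s := by
  rw [grassmannBasis_eq_prod_map_gen, chargeOp_list_prod_map_gen]
  congr 1
  rw [← List.sum_toFinset _ (Finset.sort_nodup _ _), Finset.sort_toFinset]

/-- `berezin ∘ N_q = (∑ q) · berezin` for the order-derived decidable equality. [folklore] -/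
private theorem berezin_chargeOp_lo (q : Γ → ℂ) (a : GrassmannAlgebra ℂ Γ) :
    berezin ℂ Γ (chargeOp ℂ q a) = (∑ X, q X) * berezin ℂ Γ a := by
  have h : (berezin ℂ Γ).comp (chargeOp ℂ q) = (∑ X, q X) • berezin ℂ Γ := by
    refine (grassmannBasis ℂ Γ).ext fun s => ?_
    rw [LinearMap.comp_apply, chargeOp_grassmannBasis, map_smul, LinearMap.smul_apply, smul_eq_mul,
      smul_eq_mul]
    by_cases hs : s = Finset.univ
    · subst hs; rfl
    · rw [berezin_grassmannBasis_of_ne ℂ hs, mul_zero, mul_zero]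
  have := congrArg (fun f => f a) h
  simpa using this

end GenericLO

section Generic

variable {Γ : Type*} [Fintype Γ] [LinearOrder Γ] [DecidableEq Γ]

/-- **The Berezin integral sees only the total charge**: `∫ dθ (N_q a) = (∑_X q X) ∫ dθ a` — the
top monomial carries every generator once. [cite: Berezin1966, Ch. I §3 (3.4)–(3.5)] -/
theorem berezin_chargeOp (q : Γ → ℂ) (a : GrassmannAlgebra ℂ Γ) :
    berezin ℂ Γ (chargeOp ℂ q a) = (∑ X, q X) * berezin ℂ Γ a := by
  have h := berezin_chargeOp_lo q a
  convert h using 4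

/-- **An infinitesimal symmetry with zero total charge is invisible to the Berezin integral**:
`∑_X q X = 0 ⟹ ∫ dθ N_q a = 0` ("the measure `𝒟ψ𝒟ψ̄` is invariant"). [cite: Berezin1966, Ch. I §3 (3.4)–(3.5)] -/
theorem berezin_chargeOp_eq_zero {q : Γ → ℂ} (hq : ∑ X, q X = 0) (a : GrassmannAlgebra ℂ Γ) :
    berezin ℂ Γ (chargeOp ℂ q a) = 0 := by
  rw [berezin_chargeOp, hq, zero_mul]

/-- **Selection rule of a symmetry of the weight**: if the total charge vanishes, the weight `W` is
neutral (`N_q W = 0`) and the observable `F` has a definite nonzero charge (`N_q F = cF`, `c ≠ 0`),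
then `∫ dθ F W = 0`. [cite: Berezin1966, Ch. I §3 (3.4)–(3.5)] -/
theorem berezin_mul_eq_zero_of_chargeOp_eq_smul {q : Γ → ℂ} (hq : ∑ X, q X = 0)
    {F W : GrassmannAlgebra ℂ Γ} (hW : chargeOp ℂ q W = 0) {c : ℂ} (hF : chargeOp ℂ q F = c • F)
    (hc : c ≠ 0) : berezin ℂ Γ (F * W) = 0 := by
  have h0 := berezin_chargeOp_eq_zero hq (F * W)
  rw [chargeOp_mul, hW, mul_zero, add_zero, hF, smul_mul_assoc, map_smul, smul_eq_mul] at h0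
  exact (mul_eq_zero.mp h0).resolve_left hc

omit [LinearOrder Γ] in
/-- Powers: `N_q (A^{n+1}) = (n+1) A^n N_q A` when `A` commutes with `N_q A`. [folklore] -/
private theorem chargeOp_pow_succ_of_commute (q : Γ → ℂ) {A : GrassmannAlgebra ℂ Γ}
    (hc : Commute A (chargeOp ℂ q A)) (n : ℕ) :
    chargeOp ℂ q (A ^ (n + 1)) = ((n + 1 : ℕ) : ℂ) • (A ^ n * chargeOp ℂ q A) := by
  induction n with
  | zero => simp
  | succ n ih =>
    rw [pow_succ, chargeOp_mul, ih, smul_mul_assoc, mul_assoc, ← hc.eq, ← mul_assoc, ← pow_succ]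
    rw [show (((n + 1 + 1 : ℕ) : ℂ)) = ((n + 1 : ℕ) : ℂ) + 1 by push_cast; ring, add_smul, one_smul]

omit [LinearOrder Γ] in
/-- **The charge of a Boltzmann weight**: for a nilpotent `A` commuting with `N_q A` (e.g. an even
element), `N_q e^{A} = e^{A} N_q A`. [cite: Berezin1966, Ch. I §3] -/
theorem chargeOp_grassmannExp_of_commute (q : Γ → ℂ) {A : GrassmannAlgebra ℂ Γ} (hA : IsNilpotent A)
    (hc : Commute A (chargeOp ℂ q A)) :
    chargeOp ℂ q (grassmannExp A) = grassmannExp A * chargeOp ℂ q A := by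
  obtain ⟨K, hK⟩ := hA
  have hK1 : A ^ (K + 1) = 0 := by rw [pow_succ, hK, zero_mul]
  have hL : grassmannExp A = ∑ i ∈ Finset.range (K + 1), (i.factorial : ℚ)⁻¹ • A ^ i :=
    IsNilpotent.exp_eq_sum hK1
  have hR : grassmannExp A = ∑ i ∈ Finset.range K, (i.factorial : ℚ)⁻¹ • A ^ i :=
    IsNilpotent.exp_eq_sum hK
  conv_lhs => rw [hL]
  conv_rhs => rw [hR]
  rw [map_sum, Finset.sum_mul, Finset.sum_range_succ', pow_zero, LinearMap.map_smul_of_tower, chargeOp_one,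
    smul_zero, add_zero]
  refine Finset.sum_congr rfl fun i _ => ?_
  rw [LinearMap.map_smul_of_tower, chargeOp_pow_succ_of_commute q hc i, inv_factorial_succ_smul_succ_smul,
    smul_mul_assoc]

end Generic


/-! ### Part B. The axial charge of staggered fermions and the chiral Ward identity at fixed gauge field -/

namespace StrongCoupling

open Matrix

section Axial

variable {Λ : Type*} [LinearOrder Λ] [Fintype Λ] {N : ℕ}

variable (N) in
/-- The **axial (chiral) charge** of the staggered fermions: both `ψ_a(x)` and `ψ̄_a(x)` carry the
charge `ε(x)` — the infinitesimal generator of the space-dependent chiral rotation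
`ψ(x) ↦ e^{iαε(x)}ψ(x)`, `ψ̄(x) ↦ e^{iαε(x)}ψ̄(x)` of Salmhofer–Seiler (2.7). [cite: SalmhoferSeiler1991, §2 (2.7) and (3.43)] -/
def axialCharge (ε : Λ → ℂ) : CIdx Λ N ⊕ₗ CIdx Λ N → ℂ :=
  fun w => Sum.elim (fun i : CIdx Λ N => ε (ofLex i).1) (fun i : CIdx Λ N => ε (ofLex i).1) (ofLex w)

omit [LinearOrder Λ] [Fintype Λ] in
/-- The axial charge of `ψ̄_a(x)` is `ε(x)`. [cite: SalmhoferSeiler1991, §2 (2.7)] -/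
@[simp] theorem axialCharge_barIdx (ε : Λ → ℂ) (x : Λ) (a : Fin N) :
    axialCharge N ε (barIdx (cidx x a)) = ε x := rfl

omit [LinearOrder Λ] [Fintype Λ] in
/-- The axial charge of `ψ_a(x)` is `ε(x)`. [cite: SalmhoferSeiler1991, §2 (2.7)] -/
@[simp] theorem axialCharge_psiIdx (ε : Λ → ℂ) (x : Λ) (a : Fin N) :
    axialCharge N ε (psiIdx (cidx x a)) = ε x := rfl

omit [LinearOrder Λ] in
/-- **Total axial charge** `∑_w q(w) = 2N ∑_x ε(x)` (each site carries `N` colours of `ψ` and of `ψ̄`). [cite: SalmhoferSeiler1991, §2 (2.7)] -/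
theorem sum_axialCharge (ε : Λ → ℂ) :
    ∑ w, axialCharge N ε w = 2 * N * ∑ x, ε x := by
  have h1 : ∑ w, axialCharge N ε w = ∑ w : CIdx Λ N ⊕ CIdx Λ N, axialCharge N ε (toLex w) :=
    (Fintype.sum_equiv toLex _ _ fun _ => rfl).symm
  have h2 : ∀ f : CIdx Λ N → ℂ, ∑ i : CIdx Λ N, f i = ∑ p : Λ × Fin N, f (toLex p) :=
    fun f => (Fintype.sum_equiv toLex _ _ fun _ => rfl).symm
  rw [h1, Fintype.sum_sum_type]
  simp only [axialCharge, ofLex_toLex, Sum.elim_inl, Sum.elim_inr]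
  rw [h2, Fintype.sum_prod_type]
  simp only [ofLex_toLex, Finset.sum_const, Finset.card_univ, Fintype.card_fin, nsmul_eq_mul]
  rw [Finset.mul_sum, ← Finset.sum_add_distrib]
  refine Finset.sum_congr rfl fun x _ => by ring

/-- The charge operator of the axial charge on a pair `ψ̄_i ψ_j`: weight `ε(x_i) + ε(x_j)`. [cite: SalmhoferSeiler1991, §2 (2.7)] -/
theorem chargeOp_axial_pair (ε : Λ → ℂ) (x y : Λ) (a c : Fin N) :
    chargeOp ℂ (axialCharge N ε) (pair (cidx x a) (cidx y c) : FermiAlg Λ N) =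
      (ε x + ε y) • pair (cidx x a) (cidx y c) := by
  rw [pair, psiBar, psi, chargeOp_mul, chargeOp_gen, chargeOp_gen]
  simp only [smul_mul_assoc, mul_smul_comm, add_smul]
  rfl

/-- **The meson field has axial charge `2ε(x)`**: `N_q ψ̄ψ(x) = 2ε(x) ψ̄ψ(x)`. [cite: SalmhoferSeiler1991, §2 (2.7) and (3.43)] -/
theorem chargeOp_axial_meson (ε : Λ → ℂ) (x : Λ) :
    chargeOp ℂ (axialCharge N ε) (meson x : FermiAlg Λ N) = (2 * ε x) • meson x := by
  rw [meson, map_sum, Finset.smul_sum]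
  refine Finset.sum_congr rfl fun a _ => ?_
  rw [chargeOp_axial_pair, two_mul]

/-- **The hopping term `ψ̄(x)Vψ(y)` has axial charge `ε(x) + ε(y)`** — zero on a link between sites
of opposite parity: the kinetic term of the staggered action is chirally invariant, (2.7). [cite: SalmhoferSeiler1991, §2 (2.7)] -/
theorem chargeOp_axial_hopAt (ε : Λ → ℂ) (x y : Λ) (V : Matrix (Fin N) (Fin N) ℂ) :
    chargeOp ℂ (axialCharge N ε) (hopAt x y V : FermiAlg Λ N) = (ε x + ε y) • hopAt x y V := by
  rw [hopAt, map_sum, Finset.smul_sum]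
  refine Finset.sum_congr rfl fun a _ => ?_
  rw [map_sum, Finset.smul_sum]
  refine Finset.sum_congr rfl fun c _ => ?_
  rw [map_smul, chargeOp_axial_pair, smul_comm]

variable {B : Type*} [Fintype B]

/-- **The axial charge of the action**: for links joining sites of opposite parity
(`ε(x_b) + ε(y_b) = 0`), `N_q(-S_F) = ∑_x 2mε(x) ψ̄ψ(x)` — only the mass term breaks the chiral
symmetry, for EVERY gauge field `U`. [cite: SalmhoferSeiler1991, §2 (2.7) and (3.43)] -/
theorem chargeOp_axial_negAction {ε : Λ → ℂ} (l : B → Λ × Λ) (hl : ∀ b, ε (l b).1 + ε (l b).2 = 0)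
    (Γ : B → ℂ) (m : ℂ) (U : B → OneLink.UN N) :
    chargeOp ℂ (axialCharge N ε) (negAction l Γ m U) = ∑ x, (2 * m * ε x) • (meson x : FermiAlg Λ N) := by
  rw [negAction, map_add, map_sum, map_sum]
  have h2 : ∑ b, chargeOp ℂ (axialCharge N ε) (-(Γ b / 2) • hopAt (l b).1 (l b).2 (U b : Matrix (Fin N) (Fin N) ℂ) +
      (Γ b / 2) • hopAt (l b).2 (l b).1 (U b : Matrix (Fin N) (Fin N) ℂ)ᴴ) = 0 := by
    refine Finset.sum_eq_zero fun b _ => ?_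
    rw [map_add, map_smul, map_smul, chargeOp_axial_hopAt, chargeOp_axial_hopAt, hl b,
      show ε (l b).2 + ε (l b).1 = 0 by rw [add_comm]; exact hl b, zero_smul, zero_smul, smul_zero,
      smul_zero, add_zero]
  rw [h2, add_zero]
  refine Finset.sum_congr rfl fun x _ => ?_
  rw [map_smul, chargeOp_axial_meson, smul_smul]
  ring_nf

/-- The action is even. [cite: SalmhoferSeiler1991, §2 (2.3)] -/
theorem negAction_mem_evenOdd_zero (l : B → Λ × Λ) (Γ : B → ℂ) (m : ℂ) (U : B → OneLink.UN N) :
    negAction l Γ m U ∈ CliffordAlgebra.evenOdd (0 : QuadraticForm ℂ (CIdx Λ N ⊕ₗ CIdx Λ N → ℂ)) 0 := by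
  rw [negAction]
  refine Submodule.add_mem _ (Submodule.sum_mem _ fun x _ => smul_meson_mem_evenOdd_zero m x)
    (Submodule.sum_mem _ fun b _ => Submodule.add_mem _ (smul_hopAt_mem_evenOdd_zero _ _ _ _)
      (smul_hopAt_mem_evenOdd_zero _ _ _ _))

/-- The action is nilpotent (no constant term). [cite: SalmhoferSeiler1991, §2 (2.3)] -/
theorem isNilpotent_negAction (l : B → Λ × Λ) (Γ : B → ℂ) (m : ℂ) (U : B → OneLink.UN N) :
    IsNilpotent (negAction l Γ m U) := by
  rw [negAction]
  have h1 : ∀ x, m • (meson x : FermiAlg Λ N) ∈ CliffordAlgebra.evenOdd (0 : QuadraticForm ℂ (CIdx Λ N ⊕ₗ CIdx Λ N → ℂ)) 0 :=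
    fun x => smul_meson_mem_evenOdd_zero m x
  have h2 : ∀ b, (-(Γ b / 2) • hopAt (l b).1 (l b).2 (U b : Matrix (Fin N) (Fin N) ℂ) +
      (Γ b / 2) • hopAt (l b).2 (l b).1 (U b : Matrix (Fin N) (Fin N) ℂ)ᴴ) ∈
        CliffordAlgebra.evenOdd (0 : QuadraticForm ℂ (CIdx Λ N ⊕ₗ CIdx Λ N → ℂ)) 0 :=
    fun b => Submodule.add_mem _ (smul_hopAt_mem_evenOdd_zero _ _ _ _) (smul_hopAt_mem_evenOdd_zero _ _ _ _)
  have hn2 : ∀ b, IsNilpotent (-(Γ b / 2) • hopAt (l b).1 (l b).2 (U b : Matrix (Fin N) (Fin N) ℂ) +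
      (Γ b / 2) • hopAt (l b).2 (l b).1 (U b : Matrix (Fin N) (Fin N) ℂ)ᴴ) :=
    fun b => Commute.isNilpotent_add (commute_of_mem_evenOdd_zero ℂ (smul_hopAt_mem_evenOdd_zero _ _ _ _) _)
      (isNilpotent_smul_hopAt _ _ _ _) (isNilpotent_smul_hopAt _ _ _ _)
  exact Commute.isNilpotent_add (commute_of_mem_evenOdd_zero ℂ (sum_mem_evenOdd_zero _ h1) _)
    (isNilpotent_sum_of_mem_evenOdd_zero _ h1 fun x => isNilpotent_smul_meson m x)
    (isNilpotent_sum_of_mem_evenOdd_zero _ h2 hn2)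

/-- **The axial charge of the Boltzmann weight at fixed gauge field**:
`N_q e^{-S_F(U)} = e^{-S_F(U)} · ∑_x 2mε(x) ψ̄ψ(x)` for every `U`. [cite: SalmhoferSeiler1991, §2 (2.7) and (3.43)] -/
theorem chargeOp_axial_fermiBoltzmann {ε : Λ → ℂ} (l : B → Λ × Λ) (hl : ∀ b, ε (l b).1 + ε (l b).2 = 0)
    (Γ : B → ℂ) (m : ℂ) (U : B → OneLink.UN N) :
    chargeOp ℂ (axialCharge N ε) (fermiBoltzmann l Γ m U) =
      fermiBoltzmann l Γ m U * ∑ x, (2 * m * ε x) • (meson x : FermiAlg Λ N) := by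
  rw [fermiBoltzmann, chargeOp_grassmannExp_of_commute _ (isNilpotent_negAction l Γ m U)
    (commute_of_mem_evenOdd_zero ℂ (negAction_mem_evenOdd_zero l Γ m U) _), chargeOp_axial_negAction l hl]

/-- **The chiral Ward identity (3.43), abstract form.**  Let `ε` be a sign function with
`∑_x ε(x) = 0` and `W` any element of the fermion algebra whose axial charge is that of a chirally
invariant kinetic term plus the mass term, `N_q W = W · ∑_x 2mε(x) ψ̄ψ(x)` — e.g. `W = e^{-S_F(U)}`
for any gauge field `U` (`chargeOp_axial_fermiBoltzmann`), or any gauge-field average of these with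
any weights (`β ≥ 0`).  Then for every site `y`:
`ε(y) ∫dψ̄dψ ψ̄ψ(y) W = -m ∑_x ε(x) ∫dψ̄dψ ψ̄ψ(x) ψ̄ψ(y) W`. [cite: SalmhoferSeiler1991, (3.43) and Remark 3.12] -/
theorem ward_identity_of_chargeOp_eq {ε : Λ → ℂ} (hε : ∑ x, ε x = 0) {m : ℂ} {W : FermiAlg Λ N}
    (hW : chargeOp ℂ (axialCharge N ε) W = W * ∑ x, (2 * m * ε x) • (meson x : FermiAlg Λ N)) (y : Λ) :
    ε y * berezin ℂ _ (meson y * W) =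
      -m * ∑ x, ε x * berezin ℂ _ ((meson x : FermiAlg Λ N) * meson y * W) := by
  have hq : ∑ w, axialCharge N ε w = 0 := by rw [sum_axialCharge, hε, mul_zero]
  have h0 := berezin_chargeOp_eq_zero hq ((meson y : FermiAlg Λ N) * W)
  rw [chargeOp_mul, chargeOp_axial_meson, hW, map_add, smul_mul_assoc, map_smul, smul_eq_mul,
    ← mul_assoc, Finset.mul_sum, map_sum] at h0
  have h1 : ∑ x, berezin ℂ _ ((meson y : FermiAlg Λ N) * W * ((2 * m * ε x) • meson x)) =
      2 * m * ∑ x, ε x * berezin ℂ _ ((meson x : FermiAlg Λ N) * meson y * W) := by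
    rw [Finset.mul_sum]
    refine Finset.sum_congr rfl fun x _ => ?_
    rw [mul_smul_comm, map_smul, smul_eq_mul, ← (commute_meson x ((meson y : FermiAlg Λ N) * W)).eq,
      ← mul_assoc]
    ring
  rw [h1] at h0
  linear_combination (1 / 2 : ℂ) * h0

/-- **The order parameter is axially neutral**: with `N_q W = W · ∑_x 2mε(x)ψ̄ψ(x)` and zero total
charge, `m ∑_x ε(x) ∫dψ̄dψ ψ̄ψ(x) W = 0` — the Ward identity without insertion, which is what allows
"the truncation [to] be included because of the alternating signs `ε(x)`" in (3.43). [cite: SalmhoferSeiler1991, (3.43)] -/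
theorem sum_mul_berezin_meson_eq_zero_of_chargeOp_eq {ε : Λ → ℂ} (hε : ∑ x, ε x = 0) {m : ℂ}
    {W : FermiAlg Λ N}
    (hW : chargeOp ℂ (axialCharge N ε) W = W * ∑ x, (2 * m * ε x) • (meson x : FermiAlg Λ N)) :
    m * ∑ x, ε x * berezin ℂ _ ((meson x : FermiAlg Λ N) * W) = 0 := by
  have hq : ∑ w, axialCharge N ε w = 0 := by rw [sum_axialCharge, hε, mul_zero]
  have h0 := berezin_chargeOp_eq_zero hq W
  rw [hW, Finset.mul_sum, map_sum] at h0
  have h1 : ∑ x, berezin ℂ _ (W * ((2 * m * ε x) • (meson x : FermiAlg Λ N))) =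
      2 * (m * ∑ x, ε x * berezin ℂ _ ((meson x : FermiAlg Λ N) * W)) := by
    rw [Finset.mul_sum, Finset.mul_sum]
    refine Finset.sum_congr rfl fun x _ => ?_
    rw [mul_smul_comm, map_smul, smul_eq_mul, (commute_meson x W).eq]
    ring
  rw [h1] at h0
  linear_combination (1 / 2 : ℂ) * h0

omit [LinearOrder Λ] in
/-- Algebra of the truncation: the raw identities `ε(y)b₁(y) = -m∑ε(x)b₂(x)`, `m∑ε(x)b₁(x) = 0` and
`ε(y)² = 1` give the normalised, truncated form (junk-safe: `Z = 0` allowed). [folklore] -/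
private theorem truncate_aux {ε : Λ → ℂ} {m Z : ℂ} {b₁ b₂ : Λ → ℂ} {y : Λ} (hε2 : ε y * ε y = 1)
    (h1 : ε y * b₁ y = -m * ∑ x, ε x * b₂ x) (h0 : m * ∑ x, ε x * b₁ x = 0) :
    b₁ y / Z = -m * ∑ x, ε x * ε y * (b₂ x / Z - b₁ x / Z * (b₁ y / Z)) := by
  have hsplit : ∑ x, ε x * ε y * (b₂ x / Z - b₁ x / Z * (b₁ y / Z)) =
      ε y / Z * ∑ x, ε x * b₂ x - ε y * b₁ y / Z ^ 2 * ∑ x, ε x * b₁ x := by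
    rw [Finset.mul_sum, Finset.mul_sum, ← Finset.sum_sub_distrib]
    exact Finset.sum_congr rfl fun x _ => by ring
  rw [hsplit]
  linear_combination (ε y / Z) * h1 + (-(ε y * b₁ y) / Z ^ 2) * h0 + (-(b₁ y) / Z) * hε2

omit [LinearOrder Λ] in
/-- The untruncated normalised form from the raw identity and `ε(y)² = 1`. [folklore] -/
private theorem normalise_aux {ε : Λ → ℂ} {m Z : ℂ} {b₁ b₂ : Λ → ℂ} {y : Λ} (hε2 : ε y * ε y = 1)
    (h1 : ε y * b₁ y = -m * ∑ x, ε x * b₂ x) :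
    b₁ y / Z = -m * ∑ x, ε x * ε y * (b₂ x / Z) := by
  have hsplit : ∑ x, ε x * ε y * (b₂ x / Z) = ε y / Z * ∑ x, ε x * b₂ x := by
    rw [Finset.mul_sum]
    exact Finset.sum_congr rfl fun x _ => by ring
  rw [hsplit]
  linear_combination (ε y / Z) * h1 + (-(b₁ y) / Z) * hε2

/-- **The chiral Ward identity at fixed gauge field.**  For staggered fermions with links joining
sites of opposite parity and `∑_x ε(x) = 0` (e.g. an even torus), for EVERY gauge field
configuration `U`, all link signs `Γ` and every site `y`:
`ε(y) ∫dψ̄dψ e^{-S_F(U)} ψ̄ψ(y) = -m ∑_x ε(x) ∫dψ̄dψ e^{-S_F(U)} ψ̄ψ(x)ψ̄ψ(y)` — hence (3.43) for the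
expectation of ANY lattice gauge theory with this fermion action, at every gauge coupling `β`, after
integrating `U` against its gauge-field weight. [cite: SalmhoferSeiler1991, (3.43) and §2 (2.7)] -/
theorem ward_identity_fixedGauge {ε : Λ → ℂ} (hε : ∑ x, ε x = 0) (l : B → Λ × Λ)
    (hl : ∀ b, ε (l b).1 + ε (l b).2 = 0) (Γ : B → ℂ) (m : ℂ) (U : B → OneLink.UN N) (y : Λ) :
    ε y * berezin ℂ _ ((meson y : FermiAlg Λ N) * fermiBoltzmann l Γ m U) =
      -m * ∑ x, ε x * berezin ℂ _ ((meson x : FermiAlg Λ N) * meson y * fermiBoltzmann l Γ m U) :=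
  ward_identity_of_chargeOp_eq hε (chargeOp_axial_fermiBoltzmann l hl Γ m U) y

/-- **(3.43) with truncation, at fixed gauge field**: for the fermionic expectation in the background
`U`, `⟨F⟩_U = ∫dψ̄dψ F e^{-S_F(U)} / ∫dψ̄dψ e^{-S_F(U)}` (junk `0` if the fermion determinant vanishes),
`⟨ψ̄ψ(y)⟩_U = -m ∑_x ε(x)ε(y) (⟨ψ̄ψ(x)ψ̄ψ(y)⟩_U - ⟨ψ̄ψ(x)⟩_U⟨ψ̄ψ(y)⟩_U)`, for `ε² = 1`,
`∑ε = 0`, links of opposite parity — every `U`, hence every `β`. [cite: SalmhoferSeiler1991, (3.43)] -/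
theorem ward_identity_fixedGauge_truncated {ε : Λ → ℂ} (hε : ∑ x, ε x = 0) (hε2 : ∀ x, ε x * ε x = 1)
    (l : B → Λ × Λ) (hl : ∀ b, ε (l b).1 + ε (l b).2 = 0) (Γ : B → ℂ) (m : ℂ) (U : B → OneLink.UN N)
    (y : Λ) :
    berezin ℂ _ ((meson y : FermiAlg Λ N) * fermiBoltzmann l Γ m U) / berezin ℂ _ (fermiBoltzmann l Γ m U) =
      -m * ∑ x, ε x * ε y *
        (berezin ℂ _ ((meson x : FermiAlg Λ N) * meson y * fermiBoltzmann l Γ m U) /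
            berezin ℂ _ (fermiBoltzmann l Γ m U) -
          berezin ℂ _ ((meson x : FermiAlg Λ N) * fermiBoltzmann l Γ m U) / berezin ℂ _ (fermiBoltzmann l Γ m U) *
            (berezin ℂ _ ((meson y : FermiAlg Λ N) * fermiBoltzmann l Γ m U) /
              berezin ℂ _ (fermiBoltzmann l Γ m U))) :=
  truncate_aux (b₁ := fun x => berezin ℂ _ ((meson x : FermiAlg Λ N) * fermiBoltzmann l Γ m U))
    (b₂ := fun x => berezin ℂ _ ((meson x : FermiAlg Λ N) * meson y * fermiBoltzmann l Γ m U)) (hε2 y)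
    (ward_identity_fixedGauge hε l hl Γ m U y)
    (sum_mul_berezin_meson_eq_zero_of_chargeOp_eq hε (chargeOp_axial_fermiBoltzmann l hl Γ m U))

end Axial


/-! ### Part C. Gauge-field averages: every gauge-field measure (all `β`), and the `β = 0` theory -/

section Measures

open _root_.MeasureTheory

variable {Λ : Type*} [LinearOrder Λ] [Fintype Λ] {N : ℕ} {B : Type*} [Fintype B]

/-- Integrability of `U ↦ ∫dψ̄dψ G e^{-S_F(U)}` for a constant observable `G` against any finite measure
on the (compact) gauge-field space. [cite: SalmhoferSeiler1991, §2 (2.9)–(2.12)] -/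
private theorem integrable_berezin_mul_fermiBoltzmann (l : B → Λ × Λ) (hl : ∀ b, (l b).1 ≠ (l b).2)
    (Γ : B → ℂ) (m : ℂ) (G : FermiAlg Λ N) (μ : Measure (B → OneLink.UN N)) [IsFiniteMeasure μ] :
    Integrable (fun U => berezin ℂ _ (G * fermiBoltzmann l Γ m U)) μ := by
  classical
  haveI : SecondCountableTopology (OneLink.UN N) := by
    haveI : SecondCountableTopology (Matrix (Fin N) (Fin N) ℂ) :=
      inferInstanceAs (SecondCountableTopology (Fin N → Fin N → ℂ))
    exact TopologicalSpace.Subtype.secondCountableTopology _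
  have hC : CoeffContinuous fun U => G * fermiBoltzmann (Λ := Λ) l Γ m U :=
    (CoeffContinuous.const G).mul (coeffContinuous_fermiBoltzmann l hl Γ m)
  have hI := hC.coeffIntegrable (μ := μ)
  exact hI Finset.univ

/-- **The chiral Ward identity (3.43) for an arbitrary gauge-field measure** — every gauge coupling
`β`: for links joining sites of opposite parity with distinct end points, `∑_x ε(x) = 0`, and ANY
finite measure `μ` on the gauge fields (e.g. `e^{-βS_g(U)}𝒟U`),
`ε(y) ∫dμ(U)∫dψ̄dψ e^{-S_F(U)} ψ̄ψ(y) = -m ∑_x ε(x) ∫dμ(U)∫dψ̄dψ e^{-S_F(U)} ψ̄ψ(x)ψ̄ψ(y)`. [cite: SalmhoferSeiler1991, (3.43) and §2 (2.7)] -/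
theorem ward_identity_gaugeMeasure [DecidableEq B] {ε : Λ → ℂ} (hε : ∑ x, ε x = 0) (l : B → Λ × Λ)
    (hl : ∀ b, ε (l b).1 + ε (l b).2 = 0) (hl' : ∀ b, (l b).1 ≠ (l b).2) (Γ : B → ℂ) (m : ℂ)
    (μ : Measure (B → OneLink.UN N)) [IsFiniteMeasure μ] (y : Λ) :
    ε y * ∫ U, berezin ℂ _ ((meson y : FermiAlg Λ N) * fermiBoltzmann l Γ m U) ∂μ =
      -m * ∑ x, ε x * ∫ U, berezin ℂ _ ((meson x : FermiAlg Λ N) * meson y * fermiBoltzmann l Γ m U) ∂μ := by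
  rw [← integral_const_mul]
  have hpt : (fun U => ε y * berezin ℂ _ ((meson y : FermiAlg Λ N) * fermiBoltzmann l Γ m U)) =
      fun U => ∑ x, -m * ε x * berezin ℂ _ ((meson x : FermiAlg Λ N) * meson y * fermiBoltzmann l Γ m U) := by
    funext U
    rw [ward_identity_fixedGauge hε l hl Γ m U y, Finset.mul_sum]
    exact Finset.sum_congr rfl fun x _ => by ring
  rw [hpt, integral_finsetSum _ fun x _ =>
    (integrable_berezin_mul_fermiBoltzmann l hl' Γ m _ μ).const_mul _, Finset.mul_sum]
  refine Finset.sum_congr rfl fun x _ => ?_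
  rw [integral_const_mul]; ring

/-- The Ward identity without insertion, integrated over the gauge fields:
`m ∑_x ε(x) ∫dμ(U)∫dψ̄dψ e^{-S_F(U)} ψ̄ψ(x) = 0`. [cite: SalmhoferSeiler1991, (3.43)] -/
theorem sum_mul_integral_berezin_meson_eq_zero [DecidableEq B] {ε : Λ → ℂ} (hε : ∑ x, ε x = 0)
    (l : B → Λ × Λ) (hl : ∀ b, ε (l b).1 + ε (l b).2 = 0) (hl' : ∀ b, (l b).1 ≠ (l b).2) (Γ : B → ℂ)
    (m : ℂ) (μ : Measure (B → OneLink.UN N)) [IsFiniteMeasure μ] :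
    m * ∑ x, ε x * ∫ U, berezin ℂ _ ((meson x : FermiAlg Λ N) * fermiBoltzmann l Γ m U) ∂μ = 0 := by
  have hpt : (fun U => ∑ x, m * ε x * berezin ℂ _ ((meson x : FermiAlg Λ N) * fermiBoltzmann l Γ m U)) =
      fun _ => (0 : ℂ) := by
    funext U
    have h := sum_mul_berezin_meson_eq_zero_of_chargeOp_eq hε (chargeOp_axial_fermiBoltzmann l hl Γ m U)
    rw [Finset.mul_sum] at h
    rw [← h]
    exact Finset.sum_congr rfl fun x _ => by ring
  have hint : ∫ U, ∑ x, m * ε x * berezin ℂ _ ((meson x : FermiAlg Λ N) * fermiBoltzmann l Γ m U) ∂μ = 0 := by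
    rw [hpt, integral_const, smul_zero]
  rw [integral_finsetSum _ fun x _ =>
    (integrable_berezin_mul_fermiBoltzmann l hl' Γ m _ μ).const_mul _] at hint
  rw [Finset.mul_sum, ← hint]
  refine Finset.sum_congr rfl fun x _ => ?_
  rw [integral_const_mul]; ring

/-- **(3.43) with truncation for an arbitrary gauge-field measure** (every `β`): writing
`⟨F⟩_μ = ∫dμ∫dψ̄dψ F e^{-S_F} / ∫dμ∫dψ̄dψ e^{-S_F}` (junk `0` if the denominator vanishes),
`⟨ψ̄ψ(y)⟩_μ = -m ∑_x ε(x)ε(y) (⟨ψ̄ψ(x)ψ̄ψ(y)⟩_μ - ⟨ψ̄ψ(x)⟩_μ ⟨ψ̄ψ(y)⟩_μ)`. [cite: SalmhoferSeiler1991, (3.43)] -/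
theorem ward_identity_gaugeMeasure_truncated [DecidableEq B] {ε : Λ → ℂ} (hε : ∑ x, ε x = 0)
    (hε2 : ∀ x, ε x * ε x = 1) (l : B → Λ × Λ) (hl : ∀ b, ε (l b).1 + ε (l b).2 = 0)
    (hl' : ∀ b, (l b).1 ≠ (l b).2) (Γ : B → ℂ) (m : ℂ) (μ : Measure (B → OneLink.UN N)) [IsFiniteMeasure μ]
    (y : Λ) :
    (∫ U, berezin ℂ _ ((meson y : FermiAlg Λ N) * fermiBoltzmann l Γ m U) ∂μ) /
        (∫ U, berezin ℂ _ (fermiBoltzmann (Λ := Λ) (N := N) l Γ m U) ∂μ) =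
      -m * ∑ x, ε x * ε y *
        ((∫ U, berezin ℂ _ ((meson x : FermiAlg Λ N) * meson y * fermiBoltzmann l Γ m U) ∂μ) /
            (∫ U, berezin ℂ _ (fermiBoltzmann (Λ := Λ) (N := N) l Γ m U) ∂μ) -
          (∫ U, berezin ℂ _ ((meson x : FermiAlg Λ N) * fermiBoltzmann l Γ m U) ∂μ) /
              (∫ U, berezin ℂ _ (fermiBoltzmann (Λ := Λ) (N := N) l Γ m U) ∂μ) *
            ((∫ U, berezin ℂ _ ((meson y : FermiAlg Λ N) * fermiBoltzmann l Γ m U) ∂μ) /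
              (∫ U, berezin ℂ _ (fermiBoltzmann (Λ := Λ) (N := N) l Γ m U) ∂μ))) :=
  truncate_aux (Z := ∫ U, berezin ℂ _ (fermiBoltzmann (Λ := Λ) (N := N) l Γ m U) ∂μ)
    (b₁ := fun x => ∫ U, berezin ℂ _ ((meson x : FermiAlg Λ N) * fermiBoltzmann l Γ m U) ∂μ)
    (b₂ := fun x => ∫ U, berezin ℂ _ ((meson x : FermiAlg Λ N) * meson y * fermiBoltzmann l Γ m U) ∂μ)
    (hε2 y) (ward_identity_gaugeMeasure hε l hl hl' Γ m μ y)
    (sum_mul_integral_berezin_meson_eq_zero hε l hl hl' Γ m μ)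

variable [DecidableEq B]

/-- **The axial charge of the gauge-averaged Boltzmann weight (2.19)** at `β = 0`:
`N_q ∫𝒟U e^{-S_F(U)} = (∫𝒟U e^{-S_F(U)}) · ∑_x 2mε(x)ψ̄ψ(x)`. [cite: SalmhoferSeiler1991, §2 (2.19) and (3.43)] -/
theorem chargeOp_axial_gaugeAverage {ε : Λ → ℂ} (l : B → Λ × Λ) (hl : ∀ b, ε (l b).1 + ε (l b).2 = 0)
    (hl' : ∀ b, (l b).1 ≠ (l b).2) (Γ : B → ℂ) (m : ℂ) :
    chargeOp ℂ (axialCharge N ε) (gaugeAverage (N := N) l Γ m) =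
      gaugeAverage l Γ m * ∑ x, (2 * m * ε x) • (meson x : FermiAlg Λ N) := by
  have hF := coeffIntegrable_fermiBoltzmann (Λ := Λ) (N := N) l hl' Γ m
  rw [gaugeAverage, map_cintegral _ hF]
  have hpt : (fun U => chargeOp ℂ (axialCharge N ε) (fermiBoltzmann (Λ := Λ) l Γ m U)) =
      fun U => 1 * fermiBoltzmann l Γ m U * ∑ x, (2 * m * ε x) • (meson x : FermiAlg Λ N) := by
    funext U; rw [one_mul, chargeOp_axial_fermiBoltzmann l hl]
  rw [hpt, cintegral_const_mul_mul_const _ _ hF, one_mul]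

/-- **The chiral Ward identity (3.43) for the `β = 0` unnormalised expectations** (2.9)–(2.10):
`ε(y) ∫∫ e^{-S} ψ̄ψ(y) = -m ∑_x ε(x) ∫∫ e^{-S} ψ̄ψ(x)ψ̄ψ(y)`. [cite: SalmhoferSeiler1991, (3.43) and §2 (2.9)–(2.10)] -/
theorem ward_identity_fermiBracket {ε : Λ → ℂ} (hε : ∑ x, ε x = 0) (l : B → Λ × Λ)
    (hl : ∀ b, ε (l b).1 + ε (l b).2 = 0) (hl' : ∀ b, (l b).1 ≠ (l b).2) (Γ : B → ℂ) (m : ℂ) (y : Λ) :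
    ε y * fermiBracket l Γ m (fun _ => (meson y : FermiAlg Λ N)) =
      -m * ∑ x, ε x * fermiBracket l Γ m (fun _ => ((meson x : FermiAlg Λ N) * meson y)) := by
  simp_rw [fermiBracket_const l hl']
  exact ward_identity_of_chargeOp_eq hε (chargeOp_axial_gaugeAverage l hl hl' Γ m) y

/-- The Ward identity without insertion at `β = 0`: `m ∑_x ε(x) ∫∫e^{-S} ψ̄ψ(x) = 0`. [cite: SalmhoferSeiler1991, (3.43)] -/
theorem sum_mul_fermiBracket_meson_eq_zero {ε : Λ → ℂ} (hε : ∑ x, ε x = 0) (l : B → Λ × Λ)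
    (hl : ∀ b, ε (l b).1 + ε (l b).2 = 0) (hl' : ∀ b, (l b).1 ≠ (l b).2) (Γ : B → ℂ) (m : ℂ) :
    m * ∑ x, ε x * fermiBracket l Γ m (fun _ => (meson x : FermiAlg Λ N)) = 0 := by
  simp_rw [fermiBracket_const l hl']
  exact sum_mul_berezin_meson_eq_zero_of_chargeOp_eq hε (chargeOp_axial_gaugeAverage l hl hl' Γ m)

/-- **The chiral Ward identity (3.43) for the `β = 0` expectations** (2.10), untruncated:
`⟨ψ̄ψ(y)⟩_Λ = -m ∑_x ε(x)ε(y) ⟨ψ̄ψ(x) ψ̄ψ(y)⟩_Λ`, for `ε` with `ε² = 1` pointwise, `∑_x ε(x) = 0`,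
links of opposite parity. [cite: SalmhoferSeiler1991, (3.43)] -/
theorem ward_identity_fermiExpect {ε : Λ → ℂ} (hε : ∑ x, ε x = 0) (hε2 : ∀ x, ε x * ε x = 1)
    (l : B → Λ × Λ) (hl : ∀ b, ε (l b).1 + ε (l b).2 = 0) (hl' : ∀ b, (l b).1 ≠ (l b).2) (Γ : B → ℂ)
    (m : ℂ) (y : Λ) :
    fermiExpect l Γ m (fun _ => (meson y : FermiAlg Λ N)) =
      -m * ∑ x, ε x * ε y * fermiExpect l Γ m (fun _ => ((meson x : FermiAlg Λ N) * meson y)) :=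
  normalise_aux (Z := fermiZ l Γ m) (b₁ := fun x => fermiBracket l Γ m (fun _ => (meson x : FermiAlg Λ N)))
    (b₂ := fun x => fermiBracket l Γ m (fun _ => ((meson x : FermiAlg Λ N) * meson y))) (hε2 y)
    (ward_identity_fermiBracket hε l hl hl' Γ m y)

/-- **The chiral Ward identity (3.43) for the `β = 0` expectations, printed (truncated) form**:
`⟨ψ̄ψ(y)⟩_Λ = -m ∑_x ε(x)ε(y) ⟨ψ̄ψ(x); ψ̄ψ(y)⟩^T_Λ` ("the truncation can be included because of the
alternating signs `ε(x)` in the sum"). [cite: SalmhoferSeiler1991, (3.43)] -/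
theorem ward_identity_fermiExpect_truncated {ε : Λ → ℂ} (hε : ∑ x, ε x = 0) (hε2 : ∀ x, ε x * ε x = 1)
    (l : B → Λ × Λ) (hl : ∀ b, ε (l b).1 + ε (l b).2 = 0) (hl' : ∀ b, (l b).1 ≠ (l b).2) (Γ : B → ℂ)
    (m : ℂ) (y : Λ) :
    fermiExpect l Γ m (fun _ => (meson y : FermiAlg Λ N)) =
      -m * ∑ x, ε x * ε y * (fermiExpect l Γ m (fun _ => ((meson x : FermiAlg Λ N) * meson y)) -
        fermiExpect l Γ m (fun _ => (meson x : FermiAlg Λ N)) * fermiExpect l Γ m (fun _ => (meson y : FermiAlg Λ N))) :=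
  truncate_aux (Z := fermiZ l Γ m) (b₁ := fun x => fermiBracket l Γ m (fun _ => (meson x : FermiAlg Λ N)))
    (b₂ := fun x => fermiBracket l Γ m (fun _ => ((meson x : FermiAlg Λ N) * meson y))) (hε2 y)
    (ward_identity_fermiBracket hε l hl hl' Γ m y) (sum_mul_fermiBracket_meson_eq_zero hε l hl hl' Γ m)

/-- At `β = 0`: `m ∑_x ε(x) ⟨ψ̄ψ(x)⟩_Λ = 0`. [cite: SalmhoferSeiler1991, (3.43)] -/
theorem sum_mul_fermiExpect_meson_eq_zero {ε : Λ → ℂ} (hε : ∑ x, ε x = 0) (l : B → Λ × Λ)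
    (hl : ∀ b, ε (l b).1 + ε (l b).2 = 0) (hl' : ∀ b, (l b).1 ≠ (l b).2) (Γ : B → ℂ) (m : ℂ) :
    m * ∑ x, ε x * fermiExpect l Γ m (fun _ => (meson x : FermiAlg Λ N)) = 0 := by
  have h := sum_mul_fermiBracket_meson_eq_zero (N := N) hε l hl hl' Γ m
  simp only [fermiExpect]
  calc m * ∑ x, ε x * (fermiBracket l Γ m (fun _ => (meson x : FermiAlg Λ N)) / fermiZ l Γ m)
      = (m * ∑ x, ε x * fermiBracket l Γ m (fun _ => (meson x : FermiAlg Λ N))) / fermiZ l Γ m := by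
        rw [mul_div_assoc, Finset.sum_div]
        refine congrArg _ (Finset.sum_congr rfl fun x _ => ?_)
        rw [mul_div_assoc]
    _ = 0 := by rw [h, zero_div]

end Measures

/-! ### Part D. The even torus with the staggered signs `ε(x) = (-1)^{∑ x_μ}` -/

section Torus

open Literature.Probability.LatticeModels (TorusSite)
open Literature.MathematicalPhysics.StatisticalMechanics

variable {ν L : ℕ} [NeZero L] [LinearOrder (TorusSite ν L)] {N : ℕ}

omit [LinearOrder (TorusSite ν L)] in
/-- On an even torus the staggered signs sum to zero. [cite: SalmhoferSeiler1991, §2 (2.8)] -/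
private theorem sum_axialSign_eq_zero (hL : 2 ∣ L) (hν : 1 ≤ ν) :
    ∑ x : TorusSite ν L, ((ComplexSpin.sgn hL x : ℤ) : ℂ) = 0 := by
  exact_mod_cast ComplexSpin.sum_sgn_eq_zero (ν := ν) hL hν

omit [NeZero L] [LinearOrder (TorusSite ν L)] in
/-- The torus links `(x, x + e_μ)` join sites of opposite parity. [cite: SalmhoferSeiler1991, §2 (2.8)] -/
private theorem axialSign_torusLinks (hL : 2 ∣ L) (b : TorusSite ν L × Fin ν) :
    ((ComplexSpin.sgn hL (torusLinks ν L b).1 : ℤ) : ℂ) + ((ComplexSpin.sgn hL (torusLinks ν L b).2 : ℤ) : ℂ) = 0 := by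
  simp only [torusLinks, ComplexSpin.sgn_add_single]
  push_cast; ring

omit [NeZero L] [LinearOrder (TorusSite ν L)] in
/-- The staggered sign squares to one. [cite: SalmhoferSeiler1991, §2 (2.8)] -/
private theorem axialSign_mul_self (hL : 2 ∣ L) (x : TorusSite ν L) :
    ((ComplexSpin.sgn hL x : ℤ) : ℂ) * ((ComplexSpin.sgn hL x : ℤ) : ℂ) = 1 := by
  unfold ComplexSpin.sgn; split_ifs <;> norm_num

/-- **The chiral Ward identity on the even torus at fixed gauge field.**  For staggered fermions on
`(ℤ/Lℤ)^ν` (`L` even, `ν ≥ 1`), every gauge field `U ∈ U(N)^{links}`, all link signs `Γ` and every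
complex mass: `ε(y) ∫dψ̄dψ e^{-S_F(U)} ψ̄ψ(y) = -m ∑_x ε(x) ∫dψ̄dψ e^{-S_F(U)} ψ̄ψ(x)ψ̄ψ(y)`. [cite: SalmhoferSeiler1991, (3.43) and §2 (2.7)] -/
theorem ward_identity_torus_fixedGauge (hL : 2 ∣ L) (hν : 1 ≤ ν) (Γ : TorusSite ν L × Fin ν → ℂ) (m : ℂ)
    (U : TorusSite ν L × Fin ν → OneLink.UN N) (y : TorusSite ν L) :
    ((ComplexSpin.sgn hL y : ℤ) : ℂ) * berezin ℂ _ ((meson y : FermiAlg (TorusSite ν L) N) *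
        fermiBoltzmann (torusLinks ν L) Γ m U) =
      -m * ∑ x : TorusSite ν L, ((ComplexSpin.sgn hL x : ℤ) : ℂ) *
        berezin ℂ _ ((meson x : FermiAlg (TorusSite ν L) N) * meson y * fermiBoltzmann (torusLinks ν L) Γ m U) :=
  ward_identity_fixedGauge (sum_axialSign_eq_zero hL hν) (torusLinks ν L) (axialSign_torusLinks hL) Γ m U y

/-- **The chiral Ward identity on the even torus for every gauge-field measure** (all `β`): for any
finite measure `μ` on `U(N)^{links}`,
`ε(y) ∫dμ ∫dψ̄dψ e^{-S_F} ψ̄ψ(y) = -m ∑_x ε(x) ∫dμ ∫dψ̄dψ e^{-S_F} ψ̄ψ(x)ψ̄ψ(y)`. [cite: SalmhoferSeiler1991, (3.43)] -/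
theorem ward_identity_torus_gaugeMeasure (hL : 2 ∣ L) (hL1 : 1 < L) (hν : 1 ≤ ν)
    (Γ : TorusSite ν L × Fin ν → ℂ) (m : ℂ) (μ : _root_.MeasureTheory.Measure (TorusSite ν L × Fin ν → OneLink.UN N))
    [_root_.MeasureTheory.IsFiniteMeasure μ] (y : TorusSite ν L) :
    ((ComplexSpin.sgn hL y : ℤ) : ℂ) * ∫ U, berezin ℂ _ ((meson y : FermiAlg (TorusSite ν L) N) *
        fermiBoltzmann (torusLinks ν L) Γ m U) ∂μ =
      -m * ∑ x : TorusSite ν L, ((ComplexSpin.sgn hL x : ℤ) : ℂ) *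
        ∫ U, berezin ℂ _ ((meson x : FermiAlg (TorusSite ν L) N) * meson y *
          fermiBoltzmann (torusLinks ν L) Γ m U) ∂μ :=
  ward_identity_gaugeMeasure (sum_axialSign_eq_zero hL hν) (torusLinks ν L) (axialSign_torusLinks hL)
    (torusLinks_ne hL1) Γ m μ y

/-- **Salmhofer–Seiler (3.43) for the `β = 0` `U(N)` lattice gauge theory with staggered fermions on
the even torus**: `⟨ψ̄ψ(y)⟩_Λ = -m ∑_x ε(x)ε(y) ⟨ψ̄ψ(x) ψ̄ψ(y)⟩_Λ` for the honest Berezin–Haar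
expectations `fermiExpect` of `StrongCouplingBosonisation`, every `N`, every even `L ≥ 2`, all link
signs `Γ` (in particular the staggered phases (2.4)), every complex mass. [cite: SalmhoferSeiler1991, (3.43)] -/
theorem ward_identity_torus (hL : 2 ∣ L) (hL1 : 1 < L) (hν : 1 ≤ ν) (Γ : TorusSite ν L × Fin ν → ℂ)
    (m : ℂ) (y : TorusSite ν L) :
    fermiExpect (torusLinks ν L) Γ m (fun _ => (meson y : FermiAlg (TorusSite ν L) N)) =
      -m * ∑ x : TorusSite ν L, ((ComplexSpin.sgn hL x : ℤ) : ℂ) * ((ComplexSpin.sgn hL y : ℤ) : ℂ) *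
        fermiExpect (torusLinks ν L) Γ m (fun _ => ((meson x : FermiAlg (TorusSite ν L) N) * meson y)) :=
  ward_identity_fermiExpect (sum_axialSign_eq_zero hL hν) (axialSign_mul_self hL) (torusLinks ν L)
    (axialSign_torusLinks hL) (torusLinks_ne hL1) Γ m y

/-- **Salmhofer–Seiler (3.43) on the even torus, printed (truncated) form** at `β = 0`:
`⟨ψ̄ψ(y)⟩_Λ = -m ∑_x ε(x)ε(y) ⟨ψ̄ψ(x); ψ̄ψ(y)⟩^T_Λ`. [cite: SalmhoferSeiler1991, (3.43)] -/
theorem ward_identity_torus_truncated (hL : 2 ∣ L) (hL1 : 1 < L) (hν : 1 ≤ ν)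
    (Γ : TorusSite ν L × Fin ν → ℂ) (m : ℂ) (y : TorusSite ν L) :
    fermiExpect (torusLinks ν L) Γ m (fun _ => (meson y : FermiAlg (TorusSite ν L) N)) =
      -m * ∑ x : TorusSite ν L, ((ComplexSpin.sgn hL x : ℤ) : ℂ) * ((ComplexSpin.sgn hL y : ℤ) : ℂ) *
        (fermiExpect (torusLinks ν L) Γ m (fun _ => ((meson x : FermiAlg (TorusSite ν L) N) * meson y)) -
          fermiExpect (torusLinks ν L) Γ m (fun _ => (meson x : FermiAlg (TorusSite ν L) N)) *
            fermiExpect (torusLinks ν L) Γ m (fun _ => (meson y : FermiAlg (TorusSite ν L) N))) :=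
  ward_identity_fermiExpect_truncated (sum_axialSign_eq_zero hL hν) (axialSign_mul_self hL) (torusLinks ν L)
    (axialSign_torusLinks hL) (torusLinks_ne hL1) Γ m y

/-- **(3.43) with truncation on the even torus for every gauge-field measure** (all `β`). [cite: SalmhoferSeiler1991, (3.43)] -/
theorem ward_identity_torus_gaugeMeasure_truncated (hL : 2 ∣ L) (hL1 : 1 < L) (hν : 1 ≤ ν)
    (Γ : TorusSite ν L × Fin ν → ℂ) (m : ℂ)
    (μ : _root_.MeasureTheory.Measure (TorusSite ν L × Fin ν → OneLink.UN N))
    [_root_.MeasureTheory.IsFiniteMeasure μ] (y : TorusSite ν L) :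
    (∫ U, berezin ℂ _ ((meson y : FermiAlg (TorusSite ν L) N) * fermiBoltzmann (torusLinks ν L) Γ m U) ∂μ) /
        (∫ U, berezin ℂ _ (fermiBoltzmann (Λ := TorusSite ν L) (N := N) (torusLinks ν L) Γ m U) ∂μ) =
      -m * ∑ x : TorusSite ν L, ((ComplexSpin.sgn hL x : ℤ) : ℂ) * ((ComplexSpin.sgn hL y : ℤ) : ℂ) *
        ((∫ U, berezin ℂ _ ((meson x : FermiAlg (TorusSite ν L) N) * meson y *
              fermiBoltzmann (torusLinks ν L) Γ m U) ∂μ) /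
            (∫ U, berezin ℂ _ (fermiBoltzmann (Λ := TorusSite ν L) (N := N) (torusLinks ν L) Γ m U) ∂μ) -
          (∫ U, berezin ℂ _ ((meson x : FermiAlg (TorusSite ν L) N) * fermiBoltzmann (torusLinks ν L) Γ m U) ∂μ) /
              (∫ U, berezin ℂ _ (fermiBoltzmann (Λ := TorusSite ν L) (N := N) (torusLinks ν L) Γ m U) ∂μ) *
            ((∫ U, berezin ℂ _ ((meson y : FermiAlg (TorusSite ν L) N) *
                fermiBoltzmann (torusLinks ν L) Γ m U) ∂μ) /
              (∫ U, berezin ℂ _ (fermiBoltzmann (Λ := TorusSite ν L) (N := N) (torusLinks ν L) Γ m U) ∂μ))) :=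
  ward_identity_gaugeMeasure_truncated (sum_axialSign_eq_zero hL hν) (axialSign_mul_self hL) (torusLinks ν L)
    (axialSign_torusLinks hL) (torusLinks_ne hL1) Γ m μ y

end Torus

/-! ### Part E. Mass zero: the selection rules of the exact chiral symmetry, at every gauge field

"Chiral invariance holds in the form that at mass `m = 0`, for all `β` and `g₄`, the action is
invariant under the transformation (2.7)" (p. 398); "`⟨ψ̄ψ(x)⟩_{m=0} = 0`" in finite volume (p. 400,
after (2.12) and at (2.14)); and (3.101): "At `m = 0`, because of chiral symmetry, `⟨σ₀σ_x⟩_Λ = 0`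
if `ε(x)ε(0) = 1`", equivalently (3.106) `T̂_Λ(k + π̂) = -T̂_Λ(k)` (p. 415).  The tree has (3.101) /
(3.106) for the bosonised `β = 0` system (`ComplexSpinChiralLRO`); here they are derived at FIXED
gauge field from `N_q e^{-S_F(U)}|_{m=0} = 0`, hence for every gauge-field measure (every `β`). -/

section MassZero

variable {Λ : Type*} [LinearOrder Λ] [Fintype Λ] {N : ℕ} {B : Type*} [Fintype B]

/-- **Exact chiral symmetry at `m = 0`, every gauge field**: `N_q e^{-S_F(U)}|_{m=0} = 0` for links
joining sites of opposite parity. [cite: SalmhoferSeiler1991, §2 (2.7)] -/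
theorem chargeOp_axial_fermiBoltzmann_massZero {ε : Λ → ℂ} (l : B → Λ × Λ)
    (hl : ∀ b, ε (l b).1 + ε (l b).2 = 0) (Γ : B → ℂ) (U : B → OneLink.UN N) :
    chargeOp ℂ (axialCharge N ε) (fermiBoltzmann l Γ 0 U) = 0 := by
  rw [chargeOp_axial_fermiBoltzmann l hl Γ 0 U]
  simp

/-- **Selection rule at `m = 0`, fixed gauge field**: with `∑_x ε(x) = 0`, an observable `F` of
definite nonzero axial charge has `∫dψ̄dψ F e^{-S_F(U)}|_{m=0} = 0` for EVERY `U`. [cite: SalmhoferSeiler1991, §2 (2.7) and p. 400] -/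
theorem berezin_mul_fermiBoltzmann_massZero {ε : Λ → ℂ} (hε : ∑ x, ε x = 0) (l : B → Λ × Λ)
    (hl : ∀ b, ε (l b).1 + ε (l b).2 = 0) (Γ : B → ℂ) (U : B → OneLink.UN N) {F : FermiAlg Λ N}
    {c : ℂ} (hF : chargeOp ℂ (axialCharge N ε) F = c • F) (hc : c ≠ 0) :
    berezin ℂ _ (F * fermiBoltzmann l Γ 0 U) = 0 :=
  berezin_mul_eq_zero_of_chargeOp_eq_smul (by rw [sum_axialCharge, hε, mul_zero])
    (chargeOp_axial_fermiBoltzmann_massZero l hl Γ U) hF hc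

/-- The pair of mesons `ψ̄ψ(x)ψ̄ψ(y)` has axial charge `2(ε(x) + ε(y))`. [cite: SalmhoferSeiler1991, §2 (2.7) and (3.101)] -/
theorem chargeOp_axial_meson_mul_meson {ε : Λ → ℂ} (x y : Λ) :
    chargeOp ℂ (axialCharge N ε) ((meson x : FermiAlg Λ N) * meson y) =
      (2 * (ε x + ε y)) • ((meson x : FermiAlg Λ N) * meson y) := by
  rw [chargeOp_mul, chargeOp_axial_meson, chargeOp_axial_meson, smul_mul_assoc, mul_smul_comm, ← add_smul]
  congr 1
  ring

/-- **`⟨ψ̄ψ(y)⟩_{Λ, m=0} = 0` in finite volume, at every gauge field** (p. 400): for `∑_x ε(x) = 0`,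
`ε(y) ≠ 0` and links of opposite parity, `∫dψ̄dψ ψ̄ψ(y) e^{-S_F(U)}|_{m=0} = 0` for every `U`. [cite: SalmhoferSeiler1991, §2 p. 400 ((2.13)–(2.14))] -/
theorem berezin_meson_fermiBoltzmann_massZero {ε : Λ → ℂ} (hε : ∑ x, ε x = 0) (l : B → Λ × Λ)
    (hl : ∀ b, ε (l b).1 + ε (l b).2 = 0) (Γ : B → ℂ) (U : B → OneLink.UN N) {y : Λ} (hy : ε y ≠ 0) :
    berezin ℂ _ ((meson y : FermiAlg Λ N) * fermiBoltzmann l Γ 0 U) = 0 :=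
  berezin_mul_fermiBoltzmann_massZero hε l hl Γ U (chargeOp_axial_meson ε y) (mul_ne_zero two_ne_zero hy)

/-- **(3.101) at every gauge field**: at `m = 0`, `∫dψ̄dψ ψ̄ψ(x)ψ̄ψ(y) e^{-S_F(U)} = 0` whenever
`ε(x) + ε(y) ≠ 0` (for signs: whenever `ε(x)ε(y) = 1`), for every `U`. [cite: SalmhoferSeiler1991, (3.101)] -/
theorem berezin_meson_meson_fermiBoltzmann_massZero {ε : Λ → ℂ} (hε : ∑ x, ε x = 0) (l : B → Λ × Λ)
    (hl : ∀ b, ε (l b).1 + ε (l b).2 = 0) (Γ : B → ℂ) (U : B → OneLink.UN N) {x y : Λ}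
    (hxy : ε x + ε y ≠ 0) :
    berezin ℂ _ ((meson x : FermiAlg Λ N) * meson y * fermiBoltzmann l Γ 0 U) = 0 :=
  berezin_mul_fermiBoltzmann_massZero hε l hl Γ U (chargeOp_axial_meson_mul_meson x y)
    (mul_ne_zero two_ne_zero hxy)

omit [LinearOrder Λ] [Fintype Λ] in
/-- Signs: `ε² = 1` pointwise and `ε(x) + ε(y) = 0` force `ε(x)ε(y) = -1`. [folklore] -/
private theorem mul_eq_neg_one_of_add_eq_zero {ε : Λ → ℂ} (hε2 : ∀ x, ε x * ε x = 1) {x y : Λ}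
    (h : ε x + ε y = 0) : ε x * ε y = -1 := by
  have hy : ε y = -ε x := by linear_combination h
  rw [hy]
  linear_combination (-1 : ℂ) * hε2 x

omit [LinearOrder Λ] [Fintype Λ] in
/-- The chiral grading from the selection rule, as pure algebra. [folklore] -/
private theorem grading_aux {ε : Λ → ℂ} (hε2 : ∀ x, ε x * ε x = 1) {x y : Λ} {G : ℂ}
    (hsel : ε x + ε y ≠ 0 → G = 0) : ε x * ε y * G = -G := by
  by_cases h : ε x + ε y = 0
  · rw [mul_eq_neg_one_of_add_eq_zero hε2 h]; ring
  · rw [hsel h]; ring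

/-- **The chiral grading (3.101)/(3.106) of the two-point function at `m = 0`, every gauge field**:
for signs `ε² = 1` with `∑ε = 0` and links of opposite parity,
`ε(x)ε(y) G_U(x,y) = -G_U(x,y)` where `G_U(x,y) = ∫dψ̄dψ ψ̄ψ(x)ψ̄ψ(y) e^{-S_F(U)}|_{m=0}` — i.e.
`T_Λ(x) = ½T_Λ(x)(1 - e^{iπ̂x})`, `T̂_Λ(k + π̂) = -T̂_Λ(k)` — for every `U`. [cite: SalmhoferSeiler1991, (3.101) and (3.106)] -/
theorem twoPoint_chiralGrading_fixedGauge {ε : Λ → ℂ} (hε : ∑ x, ε x = 0) (hε2 : ∀ x, ε x * ε x = 1)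
    (l : B → Λ × Λ) (hl : ∀ b, ε (l b).1 + ε (l b).2 = 0) (Γ : B → ℂ) (U : B → OneLink.UN N) (x y : Λ) :
    ε x * ε y * berezin ℂ _ ((meson x : FermiAlg Λ N) * meson y * fermiBoltzmann l Γ 0 U) =
      -berezin ℂ _ ((meson x : FermiAlg Λ N) * meson y * fermiBoltzmann l Γ 0 U) :=
  grading_aux hε2 fun h => berezin_meson_meson_fermiBoltzmann_massZero hε l hl Γ U h

/-! #### Integrated over the gauge fields: every gauge-field measure, and `β = 0` -/

open _root_.MeasureTheory in
/-- `⟨ψ̄ψ(y)⟩ = 0` at `m = 0` in finite volume for every gauge-field measure `μ`: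
`∫dμ(U)∫dψ̄dψ ψ̄ψ(y) e^{-S_F(U)}|_{m=0} = 0`. [cite: SalmhoferSeiler1991, §2 p. 400 ((2.13)–(2.14))] -/
theorem integral_berezin_meson_fermiBoltzmann_massZero {ε : Λ → ℂ} (hε : ∑ x, ε x = 0)
    (l : B → Λ × Λ) (hl : ∀ b, ε (l b).1 + ε (l b).2 = 0) (Γ : B → ℂ)
    (μ : Measure (B → OneLink.UN N)) {y : Λ} (hy : ε y ≠ 0) :
    ∫ U, berezin ℂ _ ((meson y : FermiAlg Λ N) * fermiBoltzmann l Γ 0 U) ∂μ = 0 := by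
  simp_rw [berezin_meson_fermiBoltzmann_massZero hε l hl Γ _ hy]
  exact integral_zero _ _

open _root_.MeasureTheory in
/-- (3.101) for every gauge-field measure: at `m = 0`,
`∫dμ(U)∫dψ̄dψ ψ̄ψ(x)ψ̄ψ(y) e^{-S_F(U)} = 0` whenever `ε(x) + ε(y) ≠ 0`. [cite: SalmhoferSeiler1991, (3.101)] -/
theorem integral_berezin_meson_meson_fermiBoltzmann_massZero {ε : Λ → ℂ} (hε : ∑ x, ε x = 0)
    (l : B → Λ × Λ) (hl : ∀ b, ε (l b).1 + ε (l b).2 = 0) (Γ : B → ℂ)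
    (μ : Measure (B → OneLink.UN N)) {x y : Λ} (hxy : ε x + ε y ≠ 0) :
    ∫ U, berezin ℂ _ ((meson x : FermiAlg Λ N) * meson y * fermiBoltzmann l Γ 0 U) ∂μ = 0 := by
  simp_rw [berezin_meson_meson_fermiBoltzmann_massZero hε l hl Γ _ hxy]
  exact integral_zero _ _

open _root_.MeasureTheory in
/-- The chiral grading (3.106) `T̂(k + π̂) = -T̂(k)` at `m = 0` for every gauge-field measure. [cite: SalmhoferSeiler1991, (3.101) and (3.106)] -/
theorem twoPoint_chiralGrading_gaugeMeasure {ε : Λ → ℂ} (hε : ∑ x, ε x = 0) (hε2 : ∀ x, ε x * ε x = 1)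
    (l : B → Λ × Λ) (hl : ∀ b, ε (l b).1 + ε (l b).2 = 0) (Γ : B → ℂ)
    (μ : Measure (B → OneLink.UN N)) (x y : Λ) :
    ε x * ε y * ∫ U, berezin ℂ _ ((meson x : FermiAlg Λ N) * meson y * fermiBoltzmann l Γ 0 U) ∂μ =
      -∫ U, berezin ℂ _ ((meson x : FermiAlg Λ N) * meson y * fermiBoltzmann l Γ 0 U) ∂μ :=
  grading_aux hε2 fun h => integral_berezin_meson_meson_fermiBoltzmann_massZero hε l hl Γ μ h

variable [DecidableEq B]

/-- At `β = 0`: the gauge-averaged weight is axially neutral at `m = 0`, `N_q ∫𝒟U e^{-S_F(U)}|_{m=0} = 0`. [cite: SalmhoferSeiler1991, §2 (2.7), (2.19)] -/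
theorem chargeOp_axial_gaugeAverage_massZero {ε : Λ → ℂ} (l : B → Λ × Λ)
    (hl : ∀ b, ε (l b).1 + ε (l b).2 = 0) (hl' : ∀ b, (l b).1 ≠ (l b).2) (Γ : B → ℂ) :
    chargeOp ℂ (axialCharge N ε) (gaugeAverage (N := N) l Γ 0) = 0 := by
  rw [chargeOp_axial_gaugeAverage l hl hl' Γ 0]
  simp

/-- **Selection rule for the `β = 0` expectations at `m = 0`**: an observable of definite nonzero
axial charge has `∫∫ F e^{-S}|_{m=0} = 0`. [cite: SalmhoferSeiler1991, §2 (2.7) and p. 400] -/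
theorem fermiBracket_massZero_eq_zero {ε : Λ → ℂ} (hε : ∑ x, ε x = 0) (l : B → Λ × Λ)
    (hl : ∀ b, ε (l b).1 + ε (l b).2 = 0) (hl' : ∀ b, (l b).1 ≠ (l b).2) (Γ : B → ℂ) {F : FermiAlg Λ N}
    {c : ℂ} (hF : chargeOp ℂ (axialCharge N ε) F = c • F) (hc : c ≠ 0) :
    fermiBracket l Γ 0 (fun _ => F) = 0 := by
  rw [fermiBracket_const l hl']
  exact berezin_mul_eq_zero_of_chargeOp_eq_smul (by rw [sum_axialCharge, hε, mul_zero])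
    (chargeOp_axial_gaugeAverage_massZero l hl hl' Γ) hF hc

/-- The normalised `β = 0` expectation of an observable of nonzero axial charge vanishes at `m = 0`. [cite: SalmhoferSeiler1991, §2 (2.7) and p. 400] -/
theorem fermiExpect_massZero_eq_zero {ε : Λ → ℂ} (hε : ∑ x, ε x = 0) (l : B → Λ × Λ)
    (hl : ∀ b, ε (l b).1 + ε (l b).2 = 0) (hl' : ∀ b, (l b).1 ≠ (l b).2) (Γ : B → ℂ) {F : FermiAlg Λ N}
    {c : ℂ} (hF : chargeOp ℂ (axialCharge N ε) F = c • F) (hc : c ≠ 0) :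
    fermiExpect l Γ 0 (fun _ => F) = 0 := by
  rw [fermiExpect, fermiBracket_massZero_eq_zero hε l hl hl' Γ hF hc, zero_div]

/-- **`⟨ψ̄ψ(y)⟩_{Λ, m=0} = 0`** for the `β = 0` theory in finite volume (p. 400). [cite: SalmhoferSeiler1991, §2 p. 400 ((2.13)–(2.14))] -/
theorem fermiExpect_meson_massZero {ε : Λ → ℂ} (hε : ∑ x, ε x = 0) (l : B → Λ × Λ)
    (hl : ∀ b, ε (l b).1 + ε (l b).2 = 0) (hl' : ∀ b, (l b).1 ≠ (l b).2) (Γ : B → ℂ) {y : Λ}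
    (hy : ε y ≠ 0) : fermiExpect l Γ 0 (fun _ => (meson y : FermiAlg Λ N)) = 0 :=
  fermiExpect_massZero_eq_zero hε l hl hl' Γ (chargeOp_axial_meson ε y) (mul_ne_zero two_ne_zero hy)

/-- **(3.101) for the `β = 0` theory**: `⟨ψ̄ψ(x)ψ̄ψ(y)⟩_{Λ, m=0} = 0` whenever `ε(x) + ε(y) ≠ 0`. [cite: SalmhoferSeiler1991, (3.101)] -/
theorem fermiExpect_meson_meson_massZero {ε : Λ → ℂ} (hε : ∑ x, ε x = 0) (l : B → Λ × Λ)
    (hl : ∀ b, ε (l b).1 + ε (l b).2 = 0) (hl' : ∀ b, (l b).1 ≠ (l b).2) (Γ : B → ℂ) {x y : Λ}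
    (hxy : ε x + ε y ≠ 0) :
    fermiExpect l Γ 0 (fun _ => ((meson x : FermiAlg Λ N) * meson y)) = 0 :=
  fermiExpect_massZero_eq_zero hε l hl hl' Γ (chargeOp_axial_meson_mul_meson x y)
    (mul_ne_zero two_ne_zero hxy)

/-- **(3.106) for the `β = 0` theory**: `ε(x)ε(y)⟨ψ̄ψ(x)ψ̄ψ(y)⟩_{Λ,m=0} = -⟨ψ̄ψ(x)ψ̄ψ(y)⟩_{Λ,m=0}`,
i.e. `T̂_Λ(k + π̂) = -T̂_Λ(k)`. [cite: SalmhoferSeiler1991, (3.101) and (3.106)] -/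
theorem fermiExpect_twoPoint_chiralGrading {ε : Λ → ℂ} (hε : ∑ x, ε x = 0) (hε2 : ∀ x, ε x * ε x = 1)
    (l : B → Λ × Λ) (hl : ∀ b, ε (l b).1 + ε (l b).2 = 0) (hl' : ∀ b, (l b).1 ≠ (l b).2) (Γ : B → ℂ)
    (x y : Λ) :
    ε x * ε y * fermiExpect l Γ 0 (fun _ => ((meson x : FermiAlg Λ N) * meson y)) =
      -fermiExpect l Γ 0 (fun _ => ((meson x : FermiAlg Λ N) * meson y)) :=
  grading_aux hε2 fun h => fermiExpect_meson_meson_massZero hε l hl hl' Γ h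

end MassZero

/-! #### The even torus at `m = 0` -/

section TorusMassZero

open Literature.Probability.LatticeModels (TorusSite)
open Literature.MathematicalPhysics.StatisticalMechanics

variable {ν L : ℕ} [NeZero L] [LinearOrder (TorusSite ν L)] {N : ℕ}

omit [NeZero L] [LinearOrder (TorusSite ν L)] in
/-- The staggered sign is nonzero. [cite: SalmhoferSeiler1991, §2 (2.8)] -/
private theorem axialSign_ne_zero (hL : 2 ∣ L) (x : TorusSite ν L) : ((ComplexSpin.sgn hL x : ℤ) : ℂ) ≠ 0 := by
  unfold ComplexSpin.sgn; split_ifs <;> norm_num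

/-- **`⟨ψ̄ψ(y)⟩_{Λ, m=0} = 0` on the even torus at every gauge field.** [cite: SalmhoferSeiler1991, §2 p. 400 ((2.13)–(2.14))] -/
theorem berezin_meson_torus_massZero (hL : 2 ∣ L) (hν : 1 ≤ ν) (Γ : TorusSite ν L × Fin ν → ℂ)
    (U : TorusSite ν L × Fin ν → OneLink.UN N) (y : TorusSite ν L) :
    berezin ℂ _ ((meson y : FermiAlg (TorusSite ν L) N) * fermiBoltzmann (torusLinks ν L) Γ 0 U) = 0 :=
  berezin_meson_fermiBoltzmann_massZero (sum_axialSign_eq_zero hL hν) (torusLinks ν L)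
    (axialSign_torusLinks hL) Γ U (axialSign_ne_zero hL y)

/-- **(3.101)/(3.106) on the even torus at every gauge field**: at `m = 0`,
`ε(x)ε(y) G_U(x,y) = -G_U(x,y)` for the fixed-`U` two-point function of `ψ̄ψ`. [cite: SalmhoferSeiler1991, (3.101) and (3.106)] -/
theorem twoPoint_chiralGrading_torus_fixedGauge (hL : 2 ∣ L) (hν : 1 ≤ ν)
    (Γ : TorusSite ν L × Fin ν → ℂ) (U : TorusSite ν L × Fin ν → OneLink.UN N) (x y : TorusSite ν L) :
    ((ComplexSpin.sgn hL x : ℤ) : ℂ) * ((ComplexSpin.sgn hL y : ℤ) : ℂ) *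
        berezin ℂ _ ((meson x : FermiAlg (TorusSite ν L) N) * meson y * fermiBoltzmann (torusLinks ν L) Γ 0 U) =
      -berezin ℂ _ ((meson x : FermiAlg (TorusSite ν L) N) * meson y * fermiBoltzmann (torusLinks ν L) Γ 0 U) :=
  twoPoint_chiralGrading_fixedGauge (sum_axialSign_eq_zero hL hν) (axialSign_mul_self hL) (torusLinks ν L)
    (axialSign_torusLinks hL) Γ U x y

/-- **`⟨ψ̄ψ(y)⟩_{Λ, m=0} = 0`** for the `β = 0` theory on the even torus (p. 400). [cite: SalmhoferSeiler1991, §2 p. 400 ((2.13)–(2.14))] -/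
theorem fermiExpect_meson_torus_massZero (hL : 2 ∣ L) (hL1 : 1 < L) (hν : 1 ≤ ν)
    (Γ : TorusSite ν L × Fin ν → ℂ) (y : TorusSite ν L) :
    fermiExpect (torusLinks ν L) Γ 0 (fun _ => (meson y : FermiAlg (TorusSite ν L) N)) = 0 :=
  fermiExpect_meson_massZero (sum_axialSign_eq_zero hL hν) (torusLinks ν L) (axialSign_torusLinks hL)
    (torusLinks_ne hL1) Γ (axialSign_ne_zero hL y)

/-- **(3.101) for the `β = 0` theory on the even torus**: `⟨ψ̄ψ(x)ψ̄ψ(y)⟩_{Λ,m=0} = 0` if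
`ε(x)ε(y) = 1`. [cite: SalmhoferSeiler1991, (3.101)] -/
theorem fermiExpect_meson_meson_torus_massZero (hL : 2 ∣ L) (hL1 : 1 < L) (hν : 1 ≤ ν)
    (Γ : TorusSite ν L × Fin ν → ℂ) {x y : TorusSite ν L} (hxy : ComplexSpin.sgn hL x = ComplexSpin.sgn hL y) :
    fermiExpect (torusLinks ν L) Γ 0 (fun _ => ((meson x : FermiAlg (TorusSite ν L) N) * meson y)) = 0 := by
  refine fermiExpect_meson_meson_massZero (sum_axialSign_eq_zero hL hν) (torusLinks ν L)
    (axialSign_torusLinks hL) (torusLinks_ne hL1) Γ ?_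
  rw [hxy, ← two_mul]
  exact mul_ne_zero two_ne_zero (axialSign_ne_zero hL y)

/-- **(3.106) for the `β = 0` theory on the even torus**: `T̂_Λ(k + π̂) = -T̂_Λ(k)` at `m = 0`, as
`ε(x)ε(y)⟨ψ̄ψ(x)ψ̄ψ(y)⟩_Λ = -⟨ψ̄ψ(x)ψ̄ψ(y)⟩_Λ`. [cite: SalmhoferSeiler1991, (3.101) and (3.106)] -/
theorem fermiExpect_twoPoint_chiralGrading_torus (hL : 2 ∣ L) (hL1 : 1 < L) (hν : 1 ≤ ν)
    (Γ : TorusSite ν L × Fin ν → ℂ) (x y : TorusSite ν L) :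
    ((ComplexSpin.sgn hL x : ℤ) : ℂ) * ((ComplexSpin.sgn hL y : ℤ) : ℂ) *
        fermiExpect (torusLinks ν L) Γ 0 (fun _ => ((meson x : FermiAlg (TorusSite ν L) N) * meson y)) =
      -fermiExpect (torusLinks ν L) Γ 0 (fun _ => ((meson x : FermiAlg (TorusSite ν L) N) * meson y)) :=
  fermiExpect_twoPoint_chiralGrading (sum_axialSign_eq_zero hL hν) (axialSign_mul_self hL) (torusLinks ν L)
    (axialSign_torusLinks hL) (torusLinks_ne hL1) Γ x y

end TorusMassZero

end StrongCoupling

end Literature.MathematicalPhysics.QuantumLattice
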